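/-
Copyright (c) 2026 the pub-hodgecm-mathlib formalisation cell (harness21).  Prover seat hodgecm-mathlib-A-p12 (g26): line LH4, DYADIC pay-down of `stub_N6ns`
(dealer LH4-plan (g3) word #6 2026-09-02T07:08Z, brick «SPAN-dy-unr», matrix half); 2026-09-02.
-/
import Literature.NumberTheory.Automorphic.UnitaryThreeTransvectionClassOpen   -- ★ p849223-companion (LH4-p01 (g0)): `isOpen_setOf_exists_v_B₀_sub_lt`, the odd Hensel lemma `exists_eq_mul_map_of_map_eq_self_of_v_sub_one_lt_one`; brings the corner normal form + the `B₀` invariant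
import HarnessLib

/-!
# The transvection classes of `U(σ, J₀)` over a valued field are OPEN IN THEIR STRATUM whenever `σ`-fixed principal units are norms — the residue characteristic
# plays no role (Rogawski 1990 §3.9; Serre, Local Fields V §2–§3)

Topic `NumberTheory/Automorphic`; namespace `Literature.NumberTheory.Automorphic.UnitaryGroup`.  THEOREMS ONLY (no definition, no instance, no notation, no named fact,
no `sorry`); kernel lane `--supports stmt-HodgeConjecture-24833`.  Cell `pub/hodgecm-mathlib` (D-0151), crux H413 = `stmt-HodgeConjecture-24833`; line LH4, the DYADIC
pay-down leaf `Cruxes/H413/Lines/F0_P3c_DyadicPaydown.lean` ED. 1 (LH4-plan (g3) skeleton v1 0447f09394670f4b), organ (D-SH) «Shalika at `Φ₃` at dyadic non-split places»,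
brick **«SPAN-dy-unr»** — the FIELD-GENERAL half; the CM carrier at an UNRAMIFIED non-split place is served by the sequel `Rogawski1990/UnitaryThreeUnipotentStrataUnramifiedCM`.

WHAT IS NEW.  ★ `exists_isOpen_transvection_class` (`UnitaryThreeTransvectionClassOpen`) assumes `|2| = 1` and `HenselianLocalRing 𝒪[K]`; reading its proof, BOTH enter at
exactly one step — «a `σ`-fixed principal unit `a` (`σ a = a`, `|a − 1| < 1`) is a norm `a = z·σz`» (★ `exists_eq_mul_map_of_map_eq_self_of_v_sub_one_lt_one`, Hensel on
`X² − a`).  This file re-proves the head with that step turned into the HYPOTHESIS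
`hnorm : ∀ a, σ a = a → |a − 1| < 1 → ∃ z ≠ 0, a = z·σz` and nothing else changed (the rest of the argument — corner normal form `n(t)`, the invariant value set
`{B₀(x, (g − 1)x)} = t·N(K)`, `[n(t)] = [n(t′)] ⟺ t′ ∈ t·N(K^×)` — is residue-characteristic free).  The hypothesis holds (i) at ODD residue characteristic by Hensel (★, so
the ★ head is the special case `exists_isOpen_transvection_class_of_norm … (fun a h h' => exists_eq_mul_map_of_map_eq_self_of_v_sub_one_lt_one σ hvσ h2 h h')`), and
(ii) at EVERY UNRAMIFIED quadratic `K ∕ K^σ` — dyadic included — by «`N(U_K^n) = U_{K^σ}^n`, `n ≥ 1`» [Serre1979, Ch. V §2 Prop. 3], which the tree carries as the (norm)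
field of ★ `HermitianLattice.UnramifiedLocalConjDatum` (`HermitianLatticesLocal`) and instantiates at `w.adicCompletion L` by ★ `unramifiedLocalConjDatum_adicCompletion`
(`HyperspecialUnitaryCartanAdicCompletion`, «no condition on the residue characteristic»): `exists_isOpen_transvection_class_of_unramifiedLocalConjDatum`.

RADIUS.  For the WILD (dyadic ramified) places to come, where only the `σ`-fixed principal units DEEP ENOUGH are norms (conductor of `K ∕ K^σ`, [Serre1979, Ch. V §3]), the
main head is stated with a RADIUS `|c|` (`c ∈ K`, `0 < |c| ≤ 1`): `hnorm` is asked only for `|a − 1| < |c|`, and the open set is shrunk to `V = {g | ∃ x, |B₀(x, (g−1)x) − t| < |c·t|}`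
(same argument: the quotient `a = t⁻¹·t′·N(a′)` then has `|a − 1| < |c|`).  `c = 1` is the form the odd ∕ unramified places use.

* §1 `isOpen_setOf_exists_v_B₀_sub_lt_v` (the shrunk open set), **`exists_isOpen_transvection_class_of_norm_lt`** (radius `|c|`), **`exists_isOpen_transvection_class_of_norm`**
  (`c = 1`: an open `V ⊇` the `U(σ, J₀)`-class of `g₀` with `V ∩ {transvections of U(σ, J₀)} =` that class, from `hnorm`);
* §2 `exists_isOpen_transvection_class_of_unramifiedLocalConjDatum` (the unramified instance, any residue characteristic).

HONEST LABEL: HC_CM is proved only modulo the 7 printed citations (2 remaining named inputs: hLiu418 = stmt-HodgeConjecture-24832, h413 = stmt-HodgeConjecture-24833) until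
rung 0 closes; in-house linear algebra ∕ point-set topology over a valued field, count-neutral (a brick of organ (D-SH)'s in-house road at UNRAMIFIED dyadic places; the
dyadic print row `N6nsDyadicStatement` is untouched).

## References
* [Rogawski1990] J. D. Rogawski, *Automorphic Representations of Unitary Groups in Three Variables*, Ann. of Math. Stud. 123 (1990), §3.9 p. 32, Prop. 3.9.1.
* [Serre1979] J.-P. Serre, *Local Fields*, GTM 67 (1979), Ch. V §2 Prop. 3 (`N(U_L^n) = U_K^n` in the unramified case), Ch. V §3 (ramified quadratic norm groups).
* [BernsteinZelevinsky1976] I. N. Bernstein, A. V. Zelevinsky, *Representations of the group GL(n, F) where F is a non-archimedean local field*, Russian Math. Surveys 31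
  (1976), §1.5 (l-spaces, locally closed strata).
* [PlatonovRapinchuk1994] V. Platonov, A. Rapinchuk, *Algebraic Groups and Number Theory* (1994), §3.1 (the topology of `G(K_v)`).
-/

set_option autoImplicit false

noncomputable section

open scoped Valued WithZero Matrix MatrixGroups
open Topology Set Matrix

namespace Literature.NumberTheory.Automorphic.UnitaryGroup

open Literature.NumberTheory.Automorphic Literature.NumberTheory.Automorphic.HermitianLattice

/-! ## §1 `U(σ, J₀)(K)` over a valued field `K`, `σ` an involution, `σ`-fixed units near `1` are norms (radius form, then radius `1`) -/

section MatrixSide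

variable {K : Type*} [Field K] [Valued K ℤᵐ⁰] (σ : K →+* K)

/-- The set of `g ∈ GL₃(K)` for which SOME value `B₀(x, (g − 1)x)` lies in the ball `{c′ : |c′ − t| < |d|}` is open (★ `isOpen_setOf_exists_v_B₀_sub_lt` is `d = t`).
[cite: PlatonovRapinchuk1994, §3.1] -/
theorem isOpen_setOf_exists_v_B₀_sub_lt_v (t d : K) :
    IsOpen {g : GL (Fin 3) K | ∃ x : Fin 3 → K, Valued.v (B₀ σ 3 x (((g : Matrix (Fin 3) (Fin 3) K) - 1) *ᵥ x) - t) < Valued.v d} := by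
  have hball : IsOpen {c : K | Valued.v (c - t) < Valued.v d} := by
    have h1 : IsOpen {y : K | Valued.v y < Valued.v d} := by
      simpa only [Valuation.restrict_lt_iff] using Valued.isOpen_ball K (Valued.v.restrict d)
    exact h1.preimage (continuous_id.sub continuous_const)
  have : {g : GL (Fin 3) K | ∃ x : Fin 3 → K, Valued.v (B₀ σ 3 x (((g : Matrix (Fin 3) (Fin 3) K) - 1) *ᵥ x) - t) < Valued.v d} =
      ⋃ x : Fin 3 → K, (fun g : GL (Fin 3) K => B₀ σ 3 x (((g : Matrix (Fin 3) (Fin 3) K) - 1) *ᵥ x)) ⁻¹' {c : K | Valued.v (c - t) < Valued.v d} := by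
    ext g; simp
  rw [this]
  exact isOpen_iUnion fun x => hball.preimage (continuous_B₀_sub_one_mulVec σ x)

/-- **THE TRANSVECTION CLASS IS CUT OUT BY AN OPEN SET INSIDE ITS STRATUM — norm hypothesis WITH A RADIUS, any residue characteristic** ([Rogawski1990] §3.9: the
singular unipotent classes of `U(σ, J₀)` are the `[n(t)]`, `t ∈ E⁰ ∖ 0` modulo `N E^×`; the norm class of the invariant `B₀(x, (g − 1)x) ∈ t·N(K)` is LOCALLY CONSTANT as soon as
every `σ`-fixed `a` with `|a − 1| < |c|` is a norm, `hnorm`, for some `0 < |c| ≤ 1`): for `g₀ ∈ U(σ, J₀)` with `(g₀ − 1)² = 0`, `g₀ ≠ 1`, there is an OPEN `V ⊆ GL₃(K)` (namely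
`{g | ∃ x, |B₀(x, (g−1)x) − t| < |c·t|}`, `n(t)` the corner normal form of `g₀`) containing the `U(σ, J₀)`-class of `g₀` such that every `g ∈ U(σ, J₀) ∩ V` with `(g − 1)² = 0`,
`g ≠ 1` is `U(σ, J₀)`-conjugate to `g₀`.  (= ★ `exists_isOpen_transvection_class` with its Hensel step `|2| = 1` abstracted into `hnorm` and the ball shrunk by `|c|`; the radius
serves ramified places, where only deep principal units are norms [Serre1979, Ch. V §3].) [cite: Rogawski1990, §3.9 p. 32, Prop. 3.9.1] [cite: Serre1979, Ch. V §2 Prop. 3; Ch. V §3]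
[cite: BernsteinZelevinsky1976, §1.5] -/
theorem exists_isOpen_transvection_class_of_norm_lt (hσ : ∀ z : K, σ (σ z) = z) {c : K} (hc : c ≠ 0) (hc1 : Valued.v c ≤ 1)
    (hnorm : ∀ a : K, σ a = a → Valued.v (a - 1) < Valued.v c → ∃ z : K, z ≠ 0 ∧ a = z * σ z)
    {g₀ : GL (Fin 3) K} (hg₀ : g₀ ∈ unitaryGroupOfForm σ ((StdForm.antidiagonal 3).over K))
    (hsq₀ : ((g₀ : Matrix (Fin 3) (Fin 3) K) - 1) * ((g₀ : Matrix (Fin 3) (Fin 3) K) - 1) = 0) (hne₀ : g₀ ≠ 1) :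
    ∃ V : Set (GL (Fin 3) K), IsOpen V ∧
      (∀ k ∈ unitaryGroupOfForm σ ((StdForm.antidiagonal 3).over K), k * g₀ * k⁻¹ ∈ V) ∧
      ∀ g ∈ unitaryGroupOfForm σ ((StdForm.antidiagonal 3).over K),
        ((g : Matrix (Fin 3) (Fin 3) K) - 1) * ((g : Matrix (Fin 3) (Fin 3) K) - 1) = 0 → g ≠ 1 → g ∈ V →
        ∃ k ∈ unitaryGroupOfForm σ ((StdForm.antidiagonal 3).over K), k * g₀ * k⁻¹ = g := by
  -- normal form `k₀ g₀ k₀⁻¹ = n(t)`, `t ≠ 0`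
  obtain ⟨k₀, hk₀, t, hσt, hu⟩ := exists_conj_coe_eq_cornerUnipotent_of_sq_eq_zero σ hσ hg₀ hsq₀
  have ht : t ≠ 0 := by
    intro ht0
    apply hne₀
    have h1 : k₀ * g₀ * k₀⁻¹ = 1 := Units.ext (by rw [hu, ht0, Units.val_one]; ext i j; fin_cases i <;> fin_cases j <;> rfl)
    calc g₀ = k₀⁻¹ * (k₀ * g₀ * k₀⁻¹) * k₀ := by group
      _ = 1 := by rw [h1]; group
  have htv : Valued.v t ≠ 0 := (Valuation.ne_zero_iff _).2 ht
  refine ⟨{g : GL (Fin 3) K | ∃ x : Fin 3 → K, Valued.v (B₀ σ 3 x (((g : Matrix (Fin 3) (Fin 3) K) - 1) *ᵥ x) - t) < Valued.v (c * t)},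
    isOpen_setOf_exists_v_B₀_sub_lt_v σ t (c * t), ?_, ?_⟩
  · -- the class of `g₀` lies in `V`: `k g₀ k⁻¹ = k₁ n(t) k₁⁻¹` takes the value `t` at `x = k₁ e₂`
    intro k hk
    have hk₁ : k * k₀⁻¹ ∈ unitaryGroupOfForm σ ((StdForm.antidiagonal 3).over K) := mul_mem hk (inv_mem hk₀)
    have hconj : k * g₀ * k⁻¹ = (k * k₀⁻¹) * (k₀ * g₀ * k₀⁻¹) * (k * k₀⁻¹)⁻¹ := by group
    have hmem : t * (σ 1 * 1) ∈ Set.range (fun x : Fin 3 → K => B₀ σ 3 x (((((k * k₀⁻¹) * (k₀ * g₀ * k₀⁻¹) * (k * k₀⁻¹)⁻¹ : GL (Fin 3) K) : Matrix (Fin 3) (Fin 3) K) - 1) *ᵥ x)) := by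
      rw [range_B₀_conj_sub_one_mulVec σ hu hk₁]; exact ⟨1, rfl⟩
    obtain ⟨x, hx⟩ := hmem
    beta_reduce at hx
    refine ⟨x, ?_⟩
    rw [hconj]
    have hx' : B₀ σ 3 x (((((k * k₀⁻¹) * (k₀ * g₀ * k₀⁻¹) * (k * k₀⁻¹)⁻¹ : GL (Fin 3) K) : Matrix (Fin 3) (Fin 3) K) - 1) *ᵥ x) = t := by
      rw [hx, map_one, one_mul, mul_one]
    rw [hx', sub_self, map_zero]
    exact (Valuation.pos_iff _).2 (mul_ne_zero hc ht)
  · -- a transvection in `V` is conjugate to `g₀`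
    intro g hg hsq hne ⟨x, hx⟩
    obtain ⟨k₂, hk₂, t', hσt', hu'⟩ := exists_conj_coe_eq_cornerUnipotent_of_sq_eq_zero σ hσ hg hsq
    have ht' : t' ≠ 0 := by
      intro ht0
      apply hne
      have h1 : k₂ * g * k₂⁻¹ = 1 := Units.ext (by rw [hu', ht0, Units.val_one]; ext i j; fin_cases i <;> fin_cases j <;> rfl)
      calc g = k₂⁻¹ * (k₂ * g * k₂⁻¹) * k₂ := by group
        _ = 1 := by rw [h1]; group
    -- the value at `x` reads `t'·N(a)`
    have hgconj : g = k₂⁻¹ * (k₂ * g * k₂⁻¹) * (k₂⁻¹)⁻¹ := by group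
    set a : K := (((k₂⁻¹)⁻¹ : GL (Fin 3) K) : Matrix (Fin 3) (Fin 3) K).mulVec x 2 with ha_def
    have hval : B₀ σ 3 x (((g : Matrix (Fin 3) (Fin 3) K) - 1) *ᵥ x) = t' * (σ a * a) := by
      conv_lhs => rw [hgconj]
      exact B₀_apply_conj_sub_one_mulVec σ hu' (inv_mem hk₂) x
    rw [hval] at hx
    have hct : Valued.v (c * t) ≤ Valued.v t := by
      rw [Valuation.map_mul]
      calc Valued.v c * Valued.v t ≤ 1 * Valued.v t := mul_le_mul' hc1 le_rfl
        _ = Valued.v t := one_mul _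
    have ha0 : a ≠ 0 := by
      intro h0
      rw [h0, mul_zero, mul_zero, zero_sub, Valuation.map_neg] at hx
      exact lt_irrefl _ (lt_of_lt_of_le hx hct)
    -- the quotient `t⁻¹ t' N(a)` is `σ`-fixed with `|· − 1| < |c|`, hence a norm (by `hnorm`)
    have hσa' : σ (t⁻¹ * (t' * (σ a * a))) = t⁻¹ * (t' * (σ a * a)) := by
      have hσt1 : σ t = -t := by linear_combination hσt
      have hσt2 : σ t' = -t' := by linear_combination hσt'
      rw [map_mul, map_mul, map_mul, map_inv₀, hσt1, hσt2, hσ, inv_neg]; ring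
    have hlt : Valued.v (t⁻¹ * (t' * (σ a * a)) - 1) < Valued.v c := by
      have h : t⁻¹ * (t' * (σ a * a)) - 1 = t⁻¹ * (t' * (σ a * a) - t) := by field_simp
      rw [h, Valuation.map_mul, map_inv₀]
      rw [Valuation.map_mul] at hx
      calc (Valued.v t)⁻¹ * Valued.v (t' * (σ a * a) - t) < (Valued.v t)⁻¹ * (Valued.v c * Valued.v t) := by
            exact mul_lt_mul_of_pos_left hx (inv_pos.2 (zero_lt_iff.2 htv))
        _ = Valued.v c := by rw [mul_comm (Valued.v c), ← mul_assoc, inv_mul_cancel₀ htv, one_mul]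
    obtain ⟨z, hz, hzn⟩ := hnorm _ hσa' hlt
    -- `t' = z′·σz′·t` with `z′ = z ∕ a`
    have hσa0 : σ a ≠ 0 := (map_ne_zero σ).2 ha0
    have htt' : t' = (z * a⁻¹) * σ (z * a⁻¹) * t := by
      rw [map_mul, map_inv₀]
      field_simp
      have h := hzn
      field_simp at h
      linear_combination h
    obtain ⟨k₃, hk₃, hk₃u⟩ := (exists_conj_eq_iff_exists_norm_mul σ hσ ht hu hu').2 ⟨z * a⁻¹, mul_ne_zero hz (inv_ne_zero ha0), htt'⟩
    refine ⟨k₂⁻¹ * k₃ * k₀, mul_mem (mul_mem (inv_mem hk₂) hk₃) hk₀, ?_⟩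
    calc k₂⁻¹ * k₃ * k₀ * g₀ * (k₂⁻¹ * k₃ * k₀)⁻¹ = k₂⁻¹ * (k₃ * (k₀ * g₀ * k₀⁻¹) * k₃⁻¹) * k₂ := by group
      _ = k₂⁻¹ * (k₂ * g * k₂⁻¹) * k₂ := by rw [hk₃u]
      _ = g := by group

/-- **THE TRANSVECTION CLASS IS CUT OUT BY AN OPEN SET INSIDE ITS STRATUM — norm-hypothesis form, any residue characteristic** (radius `1` of
`exists_isOpen_transvection_class_of_norm_lt`): if every `σ`-fixed principal unit is a norm (`hnorm`), then for `g₀ ∈ U(σ, J₀)` with `(g₀ − 1)² = 0`, `g₀ ≠ 1` there is an OPEN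
`V ⊆ GL₃(K)` containing the `U(σ, J₀)`-class of `g₀` such that every `g ∈ U(σ, J₀) ∩ V` with `(g − 1)² = 0`, `g ≠ 1` is `U(σ, J₀)`-conjugate to `g₀`.  ★ `exists_isOpen_transvection_class`
is the case `hnorm := exists_eq_mul_map_of_map_eq_self_of_v_sub_one_lt_one σ hvσ h2` (odd residue characteristic, Hensel). [cite: Rogawski1990, §3.9 p. 32, Prop. 3.9.1]
[cite: Serre1979, Ch. V §2 Prop. 3] [cite: BernsteinZelevinsky1976, §1.5] -/
theorem exists_isOpen_transvection_class_of_norm (hσ : ∀ z : K, σ (σ z) = z)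
    (hnorm : ∀ a : K, σ a = a → Valued.v (a - 1) < 1 → ∃ z : K, z ≠ 0 ∧ a = z * σ z)
    {g₀ : GL (Fin 3) K} (hg₀ : g₀ ∈ unitaryGroupOfForm σ ((StdForm.antidiagonal 3).over K))
    (hsq₀ : ((g₀ : Matrix (Fin 3) (Fin 3) K) - 1) * ((g₀ : Matrix (Fin 3) (Fin 3) K) - 1) = 0) (hne₀ : g₀ ≠ 1) :
    ∃ V : Set (GL (Fin 3) K), IsOpen V ∧
      (∀ k ∈ unitaryGroupOfForm σ ((StdForm.antidiagonal 3).over K), k * g₀ * k⁻¹ ∈ V) ∧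
      ∀ g ∈ unitaryGroupOfForm σ ((StdForm.antidiagonal 3).over K),
        ((g : Matrix (Fin 3) (Fin 3) K) - 1) * ((g : Matrix (Fin 3) (Fin 3) K) - 1) = 0 → g ≠ 1 → g ∈ V →
        ∃ k ∈ unitaryGroupOfForm σ ((StdForm.antidiagonal 3).over K), k * g₀ * k⁻¹ = g :=
  exists_isOpen_transvection_class_of_norm_lt σ hσ one_ne_zero (le_of_eq (Valuation.map_one _))
    (fun a hfix ha => hnorm a hfix (by rw [Valuation.map_one] at ha; exact ha)) hg₀ hsq₀ hne₀

/-! ## §2 The unramified instance: (norm) of an `UnramifiedLocalConjDatum` supplies `hnorm` at every residue characteristic -/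

/-- **Transvection classes are open in their stratum at an UNRAMIFIED quadratic `K ∕ K^σ`, dyadic included**: the (norm) field of ★ `UnramifiedLocalConjDatum σ ϖ`
(«`N(U_K^n) = U_{K^σ}^n`, `n ≥ 1`», [Serre1979, Ch. V §2 Prop. 3]) gives `hnorm` of `exists_isOpen_transvection_class_of_norm` (`z ≠ 0` because `z·σz = a ≠ 0`).
[cite: Serre1979, Ch. V §2 Prop. 3] [cite: Rogawski1990, §3.9 p. 32, Prop. 3.9.1] -/
theorem exists_isOpen_transvection_class_of_unramifiedLocalConjDatum {ϖ : K} (hd : UnramifiedLocalConjDatum σ ϖ)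
    {g₀ : GL (Fin 3) K} (hg₀ : g₀ ∈ unitaryGroupOfForm σ ((StdForm.antidiagonal 3).over K))
    (hsq₀ : ((g₀ : Matrix (Fin 3) (Fin 3) K) - 1) * ((g₀ : Matrix (Fin 3) (Fin 3) K) - 1) = 0) (hne₀ : g₀ ≠ 1) :
    ∃ V : Set (GL (Fin 3) K), IsOpen V ∧
      (∀ k ∈ unitaryGroupOfForm σ ((StdForm.antidiagonal 3).over K), k * g₀ * k⁻¹ ∈ V) ∧
      ∀ g ∈ unitaryGroupOfForm σ ((StdForm.antidiagonal 3).over K),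
        ((g : Matrix (Fin 3) (Fin 3) K) - 1) * ((g : Matrix (Fin 3) (Fin 3) K) - 1) = 0 → g ≠ 1 → g ∈ V →
        ∃ k ∈ unitaryGroupOfForm σ ((StdForm.antidiagonal 3).over K), k * g₀ * k⁻¹ = g := by
  refine exists_isOpen_transvection_class_of_norm σ hd.σσ (fun a hfix ha => ?_) hg₀ hsq₀ hne₀
  obtain ⟨z, hz, -⟩ := hd.norm a hfix ha
  have ha0 : a ≠ 0 := by
    intro h0
    rw [h0, zero_sub, Valuation.map_neg, Valuation.map_one] at ha
    exact lt_irrefl _ ha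
  refine ⟨z, fun hz0 => ha0 ?_, hz.symm⟩
  rw [← hz, hz0, zero_mul]

end MatrixSide

end Literature.NumberTheory.Automorphic.UnitaryGroup

end
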